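import Literature.Geometry.Riemannian.FamilyLaplacianRegularity
import Literature.Geometry.Riemannian.CanonicalNeighbourhoods
import Literature.Geometry.Lorentzian.RiemannianMeasureDensity
import Literature.Geometry.Lorentzian.GreenIdentity
import Literature.Analysis.Distribution.SumOfSquaresDecomposition
import Mathlib.Analysis.Matrix.PosDef
import HarnessLib

/-!
# The density ratio of two Riemannian metrics: `dV_g = ρ(g, g₀) dV_{g₀}`,
# `ρ = √(det g / det g₀) = √det(g₀⁻¹ g)`

Support file (topic `Geometry/Lorentzian`, companion of `RiemannianMeasureDensity.lean`) for the
solvability of the linear heat equation `∂ₛw = Δ_{h(s)} w − Q w` on a closed manifold (discharge of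
`Literature.Geometry.Riemannian.perelman_noLocalCollapsing`): along a family of metrics `h(s)` the
volume measures `dV_{h(s)}` are compared with the fixed measure `dV_{h₀}` through a smooth
positive density, which is what turns the space-time very weak formulation into one with a
product reference measure `dV_{h₀} ⊗ ds`.

* `PseudoRiemannianMetric.densityRatio g g₀ x = √(det (♯_{g₀} ∘ ♭_g : T_xM → T_xM))` — the
  intrinsic (basis-free) ratio of the volume densities; in any basis `(vᵢ)` of `T_xM`,
  `det(♯_{g₀} ∘ ♭_g) = det (g(vᵢ, vⱼ)) / det (g₀(vᵢ, vⱼ))` (`det_sharp_comp_flat_eq_div`), so in a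
  chart `ρ (φ⁻¹ y) · √det (g₀)ᵢⱼ(y) = √det gᵢⱼ(y)` (`densityRatio_mul_sqrt_det_chartGramMatrix`);
* `densityRatio_pos` — `ρ > 0` for Riemannian `g, g₀`;
* `riemVolume_eq_withDensity_densityRatio` — **`dV_g = ρ(g, g₀) dV_{g₀}`** as measures on a
  closed manifold modelled on `ℝᵐ` (the density-ratio lemma
  `riemannianMeasure_eq_withDensity_ofReal_of_chartGram`), with the integral form
  `integral_riemVolume_eq_integral_mul_densityRatio` (`∫ f dV_g = ∫ f ρ dV_{g₀}`);
* `IsContMDiffFamilyOn.contMDiffOn_densityRatio` — for a family `h` of metrics `C^∞` on `M × S`,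
  `(x, s) ↦ ρ(h(s), g₀)(x)` is `C^∞` on `M × S` (chart expression `√(det hᵢⱼ(y, s)/det (g₀)ᵢⱼ(y))`),
  and `continuous_densityRatio`.

This is the measure-theoretic content of "`dV_{g₁} = (dV_{g₁}/dV_{g₂}) dV_{g₂}`, the ratio of the
volume forms being `√(det g₁/det g₂)`" (Chavel 2006, §III.3, (III.3.5); Topping 2006,
Prop. 2.3.12 differentiates it along a family). Everything is proved; one definition
(`densityRatio`, with unfolding lemma), no named facts.

## References

* I. Chavel, *Riemannian Geometry: A Modern Introduction*, 2nd ed., CUP 2006, §III.3,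
  (III.3.5)–(III.3.6). [Chavel2006]
* P. Topping, *Lectures on the Ricci flow*, LMS Lecture Note Series 325, CUP 2006, Prop. 2.3.12.
  [Topping2006]
-/

noncomputable section

open Bundle Set Function Filter Manifold MeasureTheory Module
open scoped Manifold ContDiff Topology ENNReal Matrix

namespace Literature.Geometry.Lorentzian

namespace PseudoRiemannianMetric

/-! ### Linear algebra: `det(♯_{g₀} ∘ ♭_g)` in a basis -/

section Algebra

variable {EB : Type*} [NormedAddCommGroup EB] [NormedSpace ℝ EB] {HB : Type*}
  [TopologicalSpace HB] {IB : ModelWithCorners ℝ EB HB} {n : WithTop ℕ∞}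
  {B : Type*} [TopologicalSpace B] [ChartedSpace HB B]
  {F : Type*} [NormedAddCommGroup F] [NormedSpace ℝ F] [FiniteDimensional ℝ F]
  {E : B → Type*} [TopologicalSpace (TotalSpace F E)]
  [∀ b, TopologicalSpace (E b)] [∀ b, AddCommGroup (E b)] [∀ b, Module ℝ (E b)]
  [FiberBundle F E] [VectorBundle ℝ F E]

/-- **The density ratio of two metrics** at a point: `ρ(g, g₀)(b) = √det(♯_{g₀} ∘ ♭_g)`, the
square root of the determinant of the endomorphism `v ↦ ♯_{g₀}(g(v, ·))` of the fibre. For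
Riemannian `g, g₀` this is `√(det gᵢⱼ / det (g₀)ᵢⱼ)` in any basis, the ratio `dV_g/dV_{g₀}` of the
volume densities (Chavel 2006, (III.3.5)). [cite: Chavel2006, §III.3 (III.3.5)] -/
def densityRatio (g g₀ : PseudoRiemannianMetric IB n F E) (b : B) : ℝ :=
  Real.sqrt (LinearMap.det ((g₀.sharp b).toLinearMap ∘ₗ g.flat b))

/-- Unfolding `densityRatio`. [folklore] -/
theorem densityRatio_def (g g₀ : PseudoRiemannianMetric IB n F E) (b : B) :
    g.densityRatio g₀ b = Real.sqrt (LinearMap.det ((g₀.sharp b).toLinearMap ∘ₗ g.flat b)) := rfl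

omit [FiniteDimensional ℝ F] in
/-- The matrix of `♭_g : V → V*` with respect to a basis `v` and its dual basis is the transpose of
the Gram matrix `(g(vᵢ, vⱼ))`. [folklore] -/
theorem toMatrix_flat {ι : Type*} [Fintype ι] [DecidableEq ι]
    (g : PseudoRiemannianMetric IB n F E) (b : B) (v : Module.Basis ι ℝ (E b)) :
    LinearMap.toMatrix v v.dualBasis (g.flat b) = (Matrix.of fun i j ↦ g.val b (v i) (v j))ᵀ := by
  ext i j
  rw [LinearMap.toMatrix_apply, Module.Basis.dualBasis_repr, flat_apply, Matrix.transpose_apply,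
    Matrix.of_apply]

/-- **`det(♯_{g₀} ∘ ♭_g) = det gᵢⱼ / det (g₀)ᵢⱼ`** in any basis `(vᵢ)` of the fibre. [folklore] -/
theorem det_sharp_comp_flat_eq_div {ι : Type*} [Fintype ι] [DecidableEq ι]
    (g g₀ : PseudoRiemannianMetric IB n F E) (b : B) (v : Module.Basis ι ℝ (E b)) :
    LinearMap.det ((g₀.sharp b).toLinearMap ∘ₗ g.flat b) =
      (Matrix.of fun i j ↦ g.val b (v i) (v j)).det /
        (Matrix.of fun i j ↦ g₀.val b (v i) (v j)).det := by
  set Gm : Matrix ι ι ℝ := Matrix.of fun i j ↦ g.val b (v i) (v j) with hGm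
  set G0 : Matrix ι ι ℝ := Matrix.of fun i j ↦ g₀.val b (v i) (v j) with hG0
  set P : Matrix ι ι ℝ := LinearMap.toMatrix v.dualBasis v (g₀.sharp b).toLinearMap with hP
  -- `P * G0ᵀ = 1`, so `P = (G0ᵀ)⁻¹`
  have hPG : P * G0ᵀ = 1 := by
    rw [hP, hG0, ← toMatrix_flat g₀ b v, ← LinearMap.toMatrix_comp v v.dualBasis v]
    have hid : (g₀.sharp b).toLinearMap ∘ₗ g₀.flat b = LinearMap.id := by
      ext w; simp
    rw [hid, LinearMap.toMatrix_id]
  have hPinv : (G0ᵀ)⁻¹ = P := Matrix.inv_eq_left_inv hPG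
  have hM : LinearMap.toMatrix v v ((g₀.sharp b).toLinearMap ∘ₗ g.flat b) = P * Gmᵀ := by
    rw [LinearMap.toMatrix_comp v v.dualBasis v, hP, toMatrix_flat g b v]
  rw [← LinearMap.det_toMatrix v, hM, ← hPinv, Matrix.det_mul, Matrix.det_nonsing_inv,
    Matrix.det_transpose, Matrix.det_transpose, Ring.inverse_eq_inv', div_eq_inv_mul]

omit [FiniteDimensional ℝ F] in
/-- The Gram matrix of a Riemannian metric in a basis is positive definite; in particular its
determinant is positive. [folklore] -/
theorem det_gram_pos_of_isRiemannian {ι : Type*} [Fintype ι] [DecidableEq ι]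
    {g : PseudoRiemannianMetric IB n F E} (hg : g.IsRiemannian) (b : B)
    (v : Module.Basis ι ℝ (E b)) :
    0 < (Matrix.of fun i j ↦ g.val b (v i) (v j)).det := by
  have hP : (Matrix.of fun i j ↦ g.val b (v i) (v j)).PosDef := by
    refine Literature.Analysis.Distribution.posDef_of_forall_sum_pos (fun i j ↦ g.symm b _ _)
      fun c hc ↦ ?_
    have hne : ∑ i, c i • v i ≠ 0 := by
      intro h0
      apply hc
      have := v.equivFun.symm.injective (a₁ := c) (a₂ := 0)
        (by rw [Module.Basis.equivFun_symm_apply, h0, map_zero])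
      exact this
    have hexp : g.val b (∑ i, c i • v i) (∑ j, c j • v j) =
        ∑ i, ∑ j, g.val b (v i) (v j) * (c i * c j) := by
      simp only [map_sum, map_smul, _root_.sum_apply, _root_.smul_apply, smul_eq_mul]
      refine Finset.sum_congr rfl fun i _ ↦ ?_
      rw [Finset.mul_sum]
      refine Finset.sum_congr rfl fun j _ ↦ ?_
      rw [g.symm b (v j) (v i)]
      ring
    rw [← hexp]
    exact hg b _ hne
  exact hP.det_pos

end Algebra

/-! ### The density ratio on the tangent bundle: positivity and the chart identity -/

section Tangent

variable {m : ℕ} {H : Type*} [TopologicalSpace H]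
  {I : ModelWithCorners ℝ (EuclideanSpace ℝ (Fin m)) H}
  {M : Type*} [TopologicalSpace M] [ChartedSpace H M] [IsManifold I ∞ M]
  {g g₀ : PseudoRiemannianMetric I ∞ (EuclideanSpace ℝ (Fin m)) (TangentSpace I : M → Type _)}

/-- The density ratio of Riemannian metrics is positive. [folklore] -/
theorem densityRatio_pos (hg : g.IsRiemannian) (hg₀ : g₀.IsRiemannian) (x : M) :
    0 < g.densityRatio g₀ x := by
  classical
  obtain ⟨v⟩ : Nonempty (Module.Basis (Fin (Module.finrank ℝ (EuclideanSpace ℝ (Fin m)))) ℝ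
    (TangentSpace I x)) := ⟨Module.finBasis ℝ (EuclideanSpace ℝ (Fin m))⟩
  rw [densityRatio_def, det_sharp_comp_flat_eq_div g g₀ x v]
  exact Real.sqrt_pos.2 (div_pos (det_gram_pos_of_isRiemannian hg x v)
    (det_gram_pos_of_isRiemannian hg₀ x v))

/-- The density ratio is nonnegative. [folklore] -/
theorem densityRatio_nonneg (x : M) : 0 ≤ g.densityRatio g₀ x := Real.sqrt_nonneg _

/-- **The chart identity `ρ (φ⁻¹ y) √det (g₀)ᵢⱼ(y) = √det gᵢⱼ(y)`**: on the target of the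
extended chart at `x₀`, the density ratio multiplies the chart density of `g₀` into that of `g`
(both Gram matrices taken in the coordinate frame `∂ᵢ = D(φ⁻¹) eᵢ`, `chartGramMatrix`).
[cite: Chavel2006, §III.3 (III.3.5)] -/
theorem densityRatio_mul_sqrt_det_chartGramMatrix (hg : g.IsRiemannian)
    (hg₀ : g₀.IsRiemannian) (x₀ : M) {y : EuclideanSpace ℝ (Fin m)}
    (hy : y ∈ (extChartAt I x₀).target) :
    g.densityRatio g₀ ((extChartAt I x₀).symm y) *
        Real.sqrt (chartGramMatrix (g₀.toContMDiffRiemannianMetric hg₀) x₀ y).det =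
      Real.sqrt (chartGramMatrix (g.toContMDiffRiemannianMetric hg) x₀ y).det := by
  classical
  set p : M := (extChartAt I x₀).symm y with hp
  set e := trivializationAt (EuclideanSpace ℝ (Fin m)) (TangentSpace I) x₀ with he
  set b : Module.Basis (Fin m) ℝ (EuclideanSpace ℝ (Fin m)) :=
    (EuclideanSpace.basisFun (Fin m) ℝ).toBasis with hb
  have hps : p ∈ (chartAt H x₀).source := by
    rw [← extChartAt_source I]; exact (extChartAt I x₀).map_target hy
  have hpe : p ∈ e.baseSet := by rw [he, TangentBundle.trivializationAt_baseSet]; exact hps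
  set v : Module.Basis (Fin m) ℝ (TangentSpace I p) := e.basisAt b hpe with hv
  have hframe : ∀ i, e.localFrame b i p = v i := fun i ↦ e.localFrame_apply_of_mem_baseSet b hpe
  have hGg : chartGramMatrix (g.toContMDiffRiemannianMetric hg) x₀ y =
      Matrix.of fun i j ↦ g.val p (v i) (v j) := by
    ext i j
    rw [chartGramMatrix_apply_eq_val_localFrame _ x₀ hy i j, Matrix.of_apply]
    change g.val p (e.localFrame b i p) (e.localFrame b j p) = g.val p (v i) (v j)
    rw [hframe, hframe]
  have hG0 : chartGramMatrix (g₀.toContMDiffRiemannianMetric hg₀) x₀ y =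
      Matrix.of fun i j ↦ g₀.val p (v i) (v j) := by
    ext i j
    rw [chartGramMatrix_apply_eq_val_localFrame _ x₀ hy i j, Matrix.of_apply]
    change g₀.val p (e.localFrame b i p) (e.localFrame b j p) = g₀.val p (v i) (v j)
    rw [hframe, hframe]
  have h0pos := det_gram_pos_of_isRiemannian hg₀ p v
  have hgpos := det_gram_pos_of_isRiemannian hg p v
  rw [hGg, hG0, densityRatio_def, det_sharp_comp_flat_eq_div g g₀ p v,
    Real.sqrt_div hgpos.le, div_mul_cancel₀ _ (Real.sqrt_pos.2 h0pos).ne']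

end Tangent

/-! ### Smoothness of the density ratio along a smooth family -/

section Family

variable {E : Type*} [NormedAddCommGroup E] [NormedSpace ℝ E] [FiniteDimensional ℝ E]
  {H : Type*} [TopologicalSpace H] {I : ModelWithCorners ℝ E H} [I.Boundaryless]
  {M : Type*} [TopologicalSpace M] [ChartedSpace H M] [IsManifold I ∞ M]
  {h : ℝ → PseudoRiemannianMetric I ∞ E (TangentSpace I : M → Type _)} {S : Set ℝ}
  {g₀ : PseudoRiemannianMetric I ∞ E (TangentSpace I : M → Type _)}

/-- **The density ratio of a smooth family is smooth on space-time**: if `h` is a family of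
Riemannian metrics `C^∞` on `M × S` (`IsContMDiffFamilyOn ∞ h S`) and `g₀` is Riemannian, then
`(x, s) ↦ ρ(h(s), g₀)(x)` is `C^∞` on `M × S` — in the chart at `x₀` it is
`√(det hᵢⱼ(y, s) / det (g₀)ᵢⱼ(y))`, a `C^∞` function of `(y, s)` on `φ.target × S`
(`contDiffOn_gram_chart`, positivity of the Gram determinants). [cite: Topping2006, Prop. 2.3.12] -/
theorem _root_.Literature.Geometry.Riemannian.IsContMDiffFamilyOn.contMDiffOn_densityRatio
    (hh : Literature.Geometry.Riemannian.IsContMDiffFamilyOn ∞ h S)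
    (hR : ∀ s ∈ S, (h s).IsRiemannian) (hR₀ : g₀.IsRiemannian) :
    ContMDiffOn (I.prod 𝓘(ℝ, ℝ)) 𝓘(ℝ, ℝ) ∞
      (fun p : M × ℝ ↦ (h p.2).densityRatio g₀ p.1) (univ ×ˢ S) := by
  classical
  rintro ⟨x₀, t₀⟩ ⟨-, ht₀⟩
  obtain ⟨b⟩ : Nonempty (Module.Basis (Fin (Module.finrank ℝ E)) ℝ E) := ⟨Module.finBasis ℝ E⟩
  set φ := extChartAt I x₀ with hφ
  set e := trivializationAt E (TangentSpace I) x₀ with he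
  have hV : IsOpen φ.target := isOpen_extChartAt_target x₀
  -- the Gram matrices of the family and of `g₀` in the coordinate frame, smooth on `φ.target × S`
  set Gm : E × ℝ → Matrix (Fin (Module.finrank ℝ E)) (Fin (Module.finrank ℝ E)) ℝ := fun q ↦
    Matrix.of fun i j ↦ (h q.2).val (φ.symm q.1) (e.localFrame b i (φ.symm q.1))
      (e.localFrame b j (φ.symm q.1)) with hGm
  set G0 : E × ℝ → Matrix (Fin (Module.finrank ℝ E)) (Fin (Module.finrank ℝ E)) ℝ := fun q ↦
    Matrix.of fun i j ↦ g₀.val (φ.symm q.1) (e.localFrame b i (φ.symm q.1))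
      (e.localFrame b j (φ.symm q.1)) with hG0
  have hGs : ∀ i j, ContDiffOn ℝ ∞ (fun q : E × ℝ ↦ Gm q i j) (φ.target ×ˢ S) :=
    fun i j ↦ hh.contDiffOn_gram_chart x₀ b i j
  have hG0s : ∀ i j, ContDiffOn ℝ ∞ (fun q : E × ℝ ↦ G0 q i j) (φ.target ×ˢ S) :=
    fun i j ↦ ((Literature.Geometry.Riemannian.isContMDiffFamilyOn_const g₀ S).contDiffOn_gram_chart
      x₀ b i j)
  have hdet : ∀ {G : E × ℝ → Matrix (Fin (Module.finrank ℝ E)) (Fin (Module.finrank ℝ E)) ℝ},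
      (∀ i j, ContDiffOn ℝ ∞ (fun q : E × ℝ ↦ G q i j) (φ.target ×ˢ S)) →
      ContDiffOn ℝ ∞ (fun q : E × ℝ ↦ (G q).det) (φ.target ×ˢ S) := by
    intro G hG q hq
    have h1 := Literature.Geometry.Riemannian.contMDiffWithinAt_matrix_det
      (J := 𝓘(ℝ, E × ℝ)) (k := ∞) (A := G) (s := φ.target ×ˢ S) (x₀ := q)
      (fun i j ↦ contMDiffWithinAt_iff_contDiffWithinAt.2 (hG i j q hq))
    exact contMDiffWithinAt_iff_contDiffWithinAt.1 h1
  -- positivity of the determinants on `φ.target × S`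
  have hbase : ∀ q ∈ φ.target ×ˢ S, φ.symm q.1 ∈ e.baseSet := fun q hq ↦ by
    rw [he, TangentBundle.trivializationAt_baseSet, ← extChartAt_source I]
    exact φ.map_target hq.1
  have hGm_eq : ∀ q (hq : q ∈ φ.target ×ˢ S), Gm q = Matrix.of fun i j ↦
      (h q.2).val (φ.symm q.1) (e.basisAt b (hbase q hq) i) (e.basisAt b (hbase q hq) j) := by
    intro q hq; ext i j
    simp only [hGm, Matrix.of_apply, e.localFrame_apply_of_mem_baseSet b (hbase q hq)]
  have hG0_eq : ∀ q (hq : q ∈ φ.target ×ˢ S), G0 q = Matrix.of fun i j ↦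
      g₀.val (φ.symm q.1) (e.basisAt b (hbase q hq) i) (e.basisAt b (hbase q hq) j) := by
    intro q hq; ext i j
    simp only [hG0, Matrix.of_apply, e.localFrame_apply_of_mem_baseSet b (hbase q hq)]
  have hGm_pos : ∀ q ∈ φ.target ×ˢ S, 0 < (Gm q).det := fun q hq ↦ by
    rw [hGm_eq q hq]; exact det_gram_pos_of_isRiemannian (hR q.2 hq.2) _ _
  have hG0_pos : ∀ q ∈ φ.target ×ˢ S, 0 < (G0 q).det := fun q hq ↦ by
    rw [hG0_eq q hq]; exact det_gram_pos_of_isRiemannian hR₀ _ _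
  -- the coordinate expression
  set Λ : E × ℝ → ℝ := fun q ↦ Real.sqrt ((Gm q).det / (G0 q).det) with hΛ
  have hΛs : ContDiffOn ℝ ∞ Λ (φ.target ×ˢ S) :=
    ((hdet hGs).div (hdet hG0s) fun q hq ↦ (hG0_pos q hq).ne').sqrt
      fun q hq ↦ (div_pos (hGm_pos q hq) (hG0_pos q hq)).ne'
  -- compose with `(x, t) ↦ (φ x, t)`
  have hmaps : (φ.source ×ˢ S) ⊆ (fun z : M × ℝ ↦ (φ z.1, z.2)) ⁻¹' (φ.target ×ˢ S) :=
    fun z hz ↦ ⟨φ.map_source hz.1, hz.2⟩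
  have hmem : (x₀, t₀) ∈ φ.source ×ˢ S := ⟨mem_extChartAt_source x₀, ht₀⟩
  have hcomp : ContMDiffWithinAt (I.prod 𝓘(ℝ, ℝ)) 𝓘(ℝ, ℝ) ∞ (Λ ∘ fun z : M × ℝ ↦ (φ z.1, z.2))
      (φ.source ×ˢ S) (x₀, t₀) :=
    ContDiffWithinAt.comp_contMDiffWithinAt (f := fun z : M × ℝ ↦ (φ z.1, z.2)) (x := (x₀, t₀))
      (hΛs _ (hmaps hmem)) (Literature.Geometry.Riemannian.contMDiffOn_extChartAt_prod_id x₀ S _ hmem)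
      hmaps
  -- the coordinate formula `ρ(h t, g₀)(x) = Λ (φ x, t)` on `φ.source × S`
  have hagree : ∀ z ∈ φ.source ×ˢ S, (h z.2).densityRatio g₀ z.1 =
      (Λ ∘ fun z : M × ℝ ↦ (φ z.1, z.2)) z := by
    rintro ⟨x, t⟩ ⟨hx, ht⟩
    have hq : (φ x, t) ∈ φ.target ×ˢ S := ⟨φ.map_source hx, ht⟩
    have hxx : φ.symm (φ x) = x := φ.left_inv hx
    simp only [Function.comp_apply, hΛ]
    rw [hGm_eq _ hq, hG0_eq _ hq]
    conv_lhs => rw [← hxx]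
    rw [densityRatio_def, det_sharp_comp_flat_eq_div _ _ _ (e.basisAt b (hbase _ hq))]
  have hloc : ContMDiffWithinAt (I.prod 𝓘(ℝ, ℝ)) 𝓘(ℝ, ℝ) ∞
      (fun p : M × ℝ ↦ (h p.2).densityRatio g₀ p.1) (φ.source ×ˢ S) (x₀, t₀) :=
    hcomp.congr (fun z hz ↦ hagree z hz) (hagree _ hmem)
  exact hloc.mono_of_mem_nhdsWithin
    (Literature.Geometry.Riemannian.extChartAt_source_prod_mem_nhdsWithin x₀)

/-- The density ratio of two smooth Riemannian metrics is smooth. [folklore] -/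
theorem contMDiff_densityRatio {g : PseudoRiemannianMetric I ∞ E (TangentSpace I : M → Type _)}
    (hg : g.IsRiemannian) (hg₀ : g₀.IsRiemannian) :
    ContMDiff I 𝓘(ℝ, ℝ) ∞ fun x ↦ g.densityRatio g₀ x := by
  have h := (Literature.Geometry.Riemannian.isContMDiffFamilyOn_const g (univ : Set ℝ)).contMDiffOn_densityRatio
    (fun _ _ ↦ hg) hg₀
  intro x
  have h1 : ContMDiffWithinAt (I.prod 𝓘(ℝ, ℝ)) 𝓘(ℝ, ℝ) ∞
      (fun p : M × ℝ ↦ g.densityRatio g₀ p.1) (univ ×ˢ univ) (x, 0) := h (x, 0) ⟨mem_univ _, mem_univ _⟩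
  rw [univ_prod_univ, contMDiffWithinAt_univ] at h1
  have h2 : ContMDiffAt I (I.prod 𝓘(ℝ, ℝ)) ∞ (fun y : M ↦ ((y, (0 : ℝ)) : M × ℝ)) x :=
    contMDiffAt_id.prodMk contMDiffAt_const
  have h3 := h1.comp x h2
  exact h3

/-- The density ratio of two smooth Riemannian metrics is continuous. [folklore] -/
theorem continuous_densityRatio {g : PseudoRiemannianMetric I ∞ E (TangentSpace I : M → Type _)}
    (hg : g.IsRiemannian) (hg₀ : g₀.IsRiemannian) :
    Continuous fun x ↦ g.densityRatio g₀ x :=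
  (contMDiff_densityRatio hg hg₀).continuous

end Family

/-! ### `dV_g = ρ(g, g₀) dV_{g₀}` -/

section Measure

variable {m : ℕ} {H : Type*} [TopologicalSpace H]
  {I : ModelWithCorners ℝ (EuclideanSpace ℝ (Fin m)) H} [I.Boundaryless]
  {M : Type*} [TopologicalSpace M] [ChartedSpace H M] [IsManifold I ∞ M]
  [T2Space M] [CompactSpace M] [MeasurableSpace M] [BorelSpace M]
  {g g₀ : PseudoRiemannianMetric I ∞ (EuclideanSpace ℝ (Fin m)) (TangentSpace I : M → Type _)}

/-- **`dV_g = ρ(g, g₀) · dV_{g₀}`** on a closed manifold modelled on `ℝᵐ`: the Riemannian volume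
measures of two smooth Riemannian metrics differ by the smooth positive density
`ρ(g, g₀) = √(det g/det g₀)` (Chavel 2006, (III.3.5); the tree's density-ratio lemma
`riemannianMeasure_eq_withDensity_ofReal_of_chartGram` with the chart identity
`densityRatio_mul_sqrt_det_chartGramMatrix`). [cite: Chavel2006, §III.3 (III.3.5)–(III.3.6)] -/
theorem riemVolume_eq_withDensity_densityRatio (hg : g.IsRiemannian) (hg₀ : g₀.IsRiemannian) :
    g.riemVolume = g₀.riemVolume.withDensity fun x ↦ ENNReal.ofReal (g.densityRatio g₀ x) := by
  rw [riemVolume_eq hg, riemVolume_eq hg₀]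
  exact riemannianMeasure_eq_withDensity_ofReal_of_chartGram _ _
    (continuous_densityRatio hg hg₀).measurable (fun x ↦ densityRatio_nonneg x)
    fun x y hy ↦ (densityRatio_mul_sqrt_det_chartGramMatrix hg hg₀ x hy).symm

/-- **`∫ f dV_g = ∫ f ρ(g, g₀) dV_{g₀}`.** [cite: Chavel2006, §III.3 (III.3.5)–(III.3.6)] -/
theorem integral_riemVolume_eq_integral_mul_densityRatio (hg : g.IsRiemannian)
    (hg₀ : g₀.IsRiemannian) (f : M → ℝ) :
    ∫ x, f x ∂g.riemVolume = ∫ x, f x * g.densityRatio g₀ x ∂g₀.riemVolume := by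
  rw [riemVolume_eq_withDensity_densityRatio hg hg₀,
    integral_withDensity_eq_integral_toReal_smul
      (f := fun x ↦ ENNReal.ofReal (g.densityRatio g₀ x))
      (continuous_densityRatio hg hg₀).measurable.ennreal_ofReal
      (Eventually.of_forall fun x ↦ ENNReal.ofReal_lt_top)]
  refine integral_congr_ae (Eventually.of_forall fun x ↦ ?_)
  dsimp only
  rw [ENNReal.toReal_ofReal (densityRatio_nonneg x), smul_eq_mul, mul_comm]

end Measure

end PseudoRiemannianMetric

end Literature.Geometry.Lorentzian
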